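import Summits.RiemannHypothesis.RiemannHypothesis.Theses.WeilGroundState
import Summits.RiemannHypothesis.RiemannHypothesis.Theorems.WeilGroundStateGroundStatesConvergeToXiStubMellinXi
import Summits.RiemannHypothesis.RiemannHypothesis.Theorems.WeilGroundStateGroundStatesConvergeToXiStubPsiDecay
import Summits.RiemannHypothesis.RiemannHypothesis.Theorems.GroundStatesConvergeToXi.Negative.NotAttained
import Literature.NumberTheory.LFunctions.WeilGroundState
import Literature.NumberTheory.LFunctions.RHWave0HardyProofs
import Literature.Analysis.Fourier.RadialSchwartzInterpolationFourierDecay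
import HarnessLib

/-!
# Weak convergence to Riemann's kernel from convergence on the critical line
(crux item stmt-RiemannHypothesis-1527 `GroundStatesConvergeToXi`, route
route-RiemannHypothesis-WeilGroundState, line `Sketch`; `--supports`)

The line `Sketch` reduces the crux to C⁺ (`stub_tightWeakLimit`): TIGHTNESS of the renormalised
ground states `c_k u_k` in every weighted `L¹(e^{b|t|})`, `b < 1/2`, plus WEAK convergence
against test functions to Riemann's kernel `Φ(t) = 2Ψ(2t)`.  This file proves the converse half
of the transfer, making the relation LINE ⟷ CRUX exact:

* `tendsto_integral_mul_of_tendsto_criticalLine` — if `∫ |c_k u_k| ≤ M` (tightness at `b = 0`)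
  and `c_k û_k → ξ` POINTWISE ON THE CRITICAL LINE, then `c_k u_k → Φ` weakly against every
  test function.  Mechanism: for a test function `g` (a Schwartz function) write
  `g = 𝓕 (𝓕⁻ g)`; self-adjointness of `𝓕` on `L¹` (`Hardy.integral_fourier_mul_eq`, tree)
  gives the PAIRING IDENTITY
  `∫ v g = ∫ 𝓕 v · 𝓕⁻ g` (`integral_mul_eq_integral_fourier_mul_fourierInv`), where
  `𝓕 v (ξ) = v̂(1/2 − 2πiξ)` lives on the critical line; `|𝓕(c_k u_k)| ≤ M` and `𝓕⁻ g ∈ L¹`, so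
  dominated convergence and `Φ̂ = ξ` on the line (`weilMellin_phi_criticalLine`) conclude.

Consequently (file `…LineExact.lean`): C⁺ ⟺ "a witness of the crux that is tight for every
`b < 1/2`", tightness is automatic for non-negative renormalised ground states, and a witness of
the crux tight at ONE exponent `b₀ > 1/2` proves RH.
-/

noncomputable section

set_option linter.dupNamespace false

open scoped Topology Real FourierTransform
open Filter Set MeasureTheory Complex

namespace Summit.RiemannHypothesis.RiemannHypothesis.Theorems.GroundStatesConvergeToXi

open Literature.NumberTheory.LFunctions

/-! ## Fourier bookkeeping on `ℝ` -/

/-- A test function is a Schwartz function; its inverse Fourier transform is integrable.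
[folklore] -/
theorem integrable_fourierInv_of_isWeilTest {g : ℝ → ℂ} (hg : IsWeilTest g) :
    Integrable (𝓕⁻ g) := by
  have h := (𝓕⁻ (hg.2.toSchwartzMap hg.1)).integrable (μ := volume)
  rwa [SchwartzMap.fourierInv_coe] at h

/-- A test function is a Schwartz function; its Fourier transform is integrable. [folklore] -/
theorem integrable_fourier_of_isWeilTest {g : ℝ → ℂ} (hg : IsWeilTest g) :
    Integrable (𝓕 g) := by
  have h := (𝓕 (hg.2.toSchwartzMap hg.1)).integrable (μ := volume)
  rwa [SchwartzMap.fourier_coe] at h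

/-- The inverse Fourier transform of a test function is continuous (Schwartz). [folklore] -/
theorem continuous_fourierInv_of_isWeilTest {g : ℝ → ℂ} (hg : IsWeilTest g) :
    Continuous (𝓕⁻ g) := by
  have h := (𝓕⁻ (hg.2.toSchwartzMap hg.1)).continuous
  rwa [SchwartzMap.fourierInv_coe] at h

/-- Fourier inversion for test functions: `𝓕 (𝓕⁻ g) = g`. [folklore] -/
theorem fourier_fourierInv_of_isWeilTest {g : ℝ → ℂ} (hg : IsWeilTest g) : 𝓕 (𝓕⁻ g) = g :=
  hg.1.continuous.fourier_fourierInv_eq (hg.1.continuous.integrable_of_hasCompactSupport hg.2)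
    (integrable_fourier_of_isWeilTest hg)

/-- **Pairing identity through the critical line**: for integrable `v` and a test function `g`,
`∫ v g = ∫ 𝓕 v · 𝓕⁻ g` (write `g = 𝓕 (𝓕⁻ g)` and move `𝓕` across). [folklore] -/
theorem integral_mul_eq_integral_fourier_mul_fourierInv {v g : ℝ → ℂ} (hv : Integrable v)
    (hg : IsWeilTest g) :
    ∫ t, v t * g t = ∫ ξ, 𝓕 v ξ * 𝓕⁻ g ξ := by
  conv_lhs => rw [← fourier_fourierInv_of_isWeilTest hg]
  exact (Hardy.integral_fourier_mul_eq hv (integrable_fourierInv_of_isWeilTest hg)).symm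

/-- On the critical line the renormalised transform is bounded by the `L¹` norm:
`‖c · û(1/2 + iτ)‖ ≤ ∫ ‖c u‖`. [folklore] -/
theorem norm_const_mul_weilMellin_criticalLine_le {u : ℝ → ℂ} (c : ℂ) (τ : ℝ) :
    ‖c * weilMellin u (1 / 2 + τ * I)‖ ≤ ∫ t, ‖c * u t‖ := by
  rw [← weilMellin_const_mul, weilMellin]
  refine (norm_integral_le_integral_norm _).trans (le_of_eq ?_)
  refine integral_congr_ae (ae_of_all _ fun t => ?_)
  exact Negative.norm_mul_cexp_criticalLine (c * u t) τ t

/-! ## Weak convergence from convergence on the critical line -/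

/-- **Weak limit from the critical line (RH-free).**  Let `u_k : ℝ → ℂ` be integrable and
`c_k : ℂ` with `∫ ‖c_k u_k‖ ≤ M` for all `k` (tightness at exponent `b = 0`), and suppose
`c_k · û_k(1/2 + iτ) → ξ(1/2 + iτ)` for every real `τ`.  Then `c_k u_k → Φ = 2Ψ(2·)` weakly
against every test function: `∫ c_k u_k g → ∫ Φ g`.  Proof: by the pairing identity
`∫ c_k u_k g = ∫ 𝓕(c_k u_k) · 𝓕⁻ g` with `𝓕(c_k u_k)(ξ) = c_k û_k(1/2 − 2πiξ)` bounded by `M`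
and convergent pointwise to `ξ(1/2 − 2πiξ) = 𝓕 Φ (ξ)` (`weilMellin_phi_criticalLine`); `𝓕⁻ g`
is integrable (Schwartz), so dominated convergence gives `∫ 𝓕 Φ · 𝓕⁻ g = ∫ Φ g`. -/
theorem tendsto_integral_mul_of_tendsto_criticalLine
    {u : ℕ → ℝ → ℂ} {c : ℕ → ℂ} (hu : ∀ k, Integrable (u k))
    (hM : ∃ M : ℝ, ∀ k, ∫ t, ‖c k * u k t‖ ≤ M)
    (hline : ∀ τ : ℝ, Tendsto (fun k => c k * weilMellin (u k) (1 / 2 + τ * I)) atTop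
      (𝓝 (riemannXi (1 / 2 + τ * I))))
    {g : ℝ → ℂ} (hg : IsWeilTest g) :
    Tendsto (fun k => ∫ t, c k * u k t * g t) atTop
      (𝓝 (∫ t, 2 * LagariasMontague.Psic (2 * t) * g t)) := by
  obtain ⟨M, hM⟩ := hM
  have hGint : Integrable (𝓕⁻ g) := integrable_fourierInv_of_isWeilTest hg
  -- both sides through the pairing identity
  have hk : ∀ k, ∫ t, c k * u k t * g t = ∫ ξ, 𝓕 (fun t => c k * u k t) ξ * 𝓕⁻ g ξ := fun k =>
    integral_mul_eq_integral_fourier_mul_fourierInv ((hu k).const_mul (c k)) hg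
  have hΦint : Integrable fun t : ℝ => (2 : ℂ) * LagariasMontague.Psic (2 * t) := by
    simpa using integrable_phi_mul_cexp stub_psiDecay.2 (1 / 2)
  have hΦ : ∫ t, 2 * LagariasMontague.Psic (2 * t) * g t =
      ∫ ξ, 𝓕 (fun t : ℝ => (2 : ℂ) * LagariasMontague.Psic (2 * t)) ξ * 𝓕⁻ g ξ :=
    integral_mul_eq_integral_fourier_mul_fourierInv hΦint hg
  simp_rw [hk]
  rw [hΦ]
  refine tendsto_integral_of_dominated_convergence (fun ξ => M * ‖𝓕⁻ g ξ‖) (fun k => ?_)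
    (hGint.norm.const_mul M) (fun k => ae_of_all _ fun ξ => ?_) (ae_of_all _ fun ξ => ?_)
  · exact ((Literature.Analysis.Fourier.continuous_fourier_real ((hu k).const_mul (c k))).mul
      (continuous_fourierInv_of_isWeilTest hg)).aestronglyMeasurable
  · rw [norm_mul]
    refine mul_le_mul_of_nonneg_right ?_ (norm_nonneg _)
    rw [Negative.fourier_eq_weilMellin, weilMellin_const_mul]
    exact (norm_const_mul_weilMellin_criticalLine_le (c k) _).trans (hM k)
  · have h1 : ∀ k, 𝓕 (fun t => c k * u k t) ξ =
        c k * weilMellin (u k) (1 / 2 + ((-2 * π * ξ : ℝ) : ℂ) * I) := fun k => by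
      rw [Negative.fourier_eq_weilMellin, weilMellin_const_mul]
    have h2 : 𝓕 (fun t : ℝ => (2 : ℂ) * LagariasMontague.Psic (2 * t)) ξ =
        riemannXi (1 / 2 + ((-2 * π * ξ : ℝ) : ℂ) * I) := by
      rw [Negative.fourier_eq_weilMellin, weilMellin_phi_criticalLine]
    simp_rw [h1, h2]
    exact (hline _).mul_const _

end Summit.RiemannHypothesis.RiemannHypothesis.Theorems.GroundStatesConvergeToXi

end
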